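import Summits.QuantumFields.BalabanUV.T4Continuum.Spine.NE1p.DressedRoot
import Literature.MathematicalPhysics.QuantumFieldTheory.Balaban1983to89.T4FeltGeometry

/-!
# T⁴ programme, spine estimate NE1′ (node O3b/H2) — leaf L-C ((w3-book)): THE LIVE-FAMILY COUNT OF A MET COMPONENT
# (`BookingLeaves.hS` ∕ `BookingLeaves.hcount`) FROM THE COMPONENT'S CUBES AND THE BOOKING'S POSITIONAL COUNT

Cell `pub-balaban`, sub-cell `t4`, BINDER-OWNERS row NE1′; formalisation swarm `b2b-balaban-t4-ne1p-formalise-*`, crew row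
**S4** of `t4/formal/NE1p/LEAVES.md` (owner skeleton `t4/skeletons/NE1p-t4-ne1p-p1.md` v1.1 §2 leaf L-C, §6 seat S4; trigger
`t4/T4-NE1p-TRIGGER.json` pass 63 c1); unit `b2b-balaban-t4-ne1p-formalise-leaf-10`.  ADDITIVE — imports `Spine/NE1p/DressedRoot`
(for the field shapes of `DressedRoot.BookingLeaves`) and `Literature/…/T4FeltGeometry` (the anchoring supplier) ONLY;
modifies nothing.

WHAT THE LEAF IS.  END-B (`DressedRoot.dressedStability_of_bookingLeaves`) asks, per cutoff, for the per-met-component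
finsets `S k b` of LIVE FAMILIES with
* `hS     : ∀ k b, ∀ f ∈ S k b, Bk.birthScale f ≤ k` (live families are born), and
* `hcount : ∀ k b, ∀ j ≤ k, #((S k b).filter (birthScale · = j)) ≤ U.N₀ · U.Λ^{k−j}` (positional count of the live
  families per birth scale, K-FREE constants `N₀`, `Λ` of `DressedRoot.UniformConstants`).
This module DISCHARGES both from COUNTING SHADOWS ONLY, in two layers:
* §1 `positionalCount_mono` — the booking's `PositionalCount` is monotone in its profile (so ONE `U.N₀` serves both this
  leaf and the `hcount` of `DressedRoot.cubeBudget_of_bookingLeaves`).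
* §2 (abstract layer) the met component of `b` at step `k` is given by its finset of CUBES OF SCALE `k` (with collars —
  the `T4PreservedUnderR.RStep.comp` currency), the live families are HOUSED in it (each is felt at one of its cubes —
  the `RStep.FeltHome` currency), the component has at most `v` cubes (`RStep.CompVol` currency) and the booking has
  `PositionalCount N`: then `hS` holds (`birthScale_le_of_housed`, from `Booking.felt_birth_le`) and
  `#((S k b).filter (birthScale · = j)) ≤ v · N j k` (`card_filter_live_le`), hence `≤ N₀′·Λ^{k−j}` for any displayed
  `(N₀′, Λ)` with `v·N j k ≤ N₀′·Λ^{k−j}` (`count_of_housed`) — LITERALLY the field type of `BookingLeaves.hcount`.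
* §3 (anchoring instance) with a block-lattice anchoring `A : T4FeltGeometry.Anchoring Bk d L` (`0 < L`) of per-block
  multiplicity `m`, `T4FeltGeometry.Anchoring.positionalCount_of_anchoring` BY NAME gives `N j k = m·(L^d)^{k−j}`, so
  `hcount` holds with `N₀ = v·m`, `Λ = L^d` (`count_of_anchoring`); and the component volume `v = ℓ^d` when the component's
  cubes have distinct blocks inside a box of `ℓ` blocks per side (`card_le_of_center_box`, `count_of_anchoring_box`) —
  the form in which a COLLARED met component (a component of the large-field region inside a cube of `100M R_k`,
  [Balaban1988Convergent] (2.3) p. 255, plus its collar layers, `B16PostRGeom`) is K-free (located risk R4 ∕ R-GEOMSPLIT′ of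
  the skeleton: `ℓ` is a DISPLAYED binder, no numeral is asserted from print).
* §4 `bookingCount_of_anchoring` — the two conclusions packaged as the conjunction `hS ∧ hcount` with the `U.N₀`, `U.Λ` of
  a `DressedRoot.UniformConstants` under the displayed comparison `v·m ≤ U.N₀`, `U.Λ = L^d`; `positionalCount_uniform` — the
  SAME `U` serves the booking-level count of `DressedRoot.cubeBudget_of_bookingLeaves`.
* §6 (v1.1, append-only) `count_of_rstep_absorbs` ∕ `count_of_rstep_absorbs_anchoring` — in the dictionary `S k b :=
  (R k).absorbs (home k b)` (the old families absorbed at the component's new birth) the HOUSING binder IS the `RStep` axiom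
  `absorbs_felt`, so `hS ∧ hcount` follow from `CompVol v` + the positional count ALONE; `birthScale_lt_of_absorbs`.
* v1.2 (courier restore, NO declaration changed): the v1.1 bytes of p212973 (sha16 2f8a5b06a531069c) re-filed by seat
  `…-leaf-02` (gen 5) after the stale v1 proposal p212511 applied out of order (2026-08-20T11:49:57Z) and regressed the tree
  file to v1, dropping §6 — typer R-T64 (vi) hazard, remedy of record; authorship of every line stays with `…-leaf-10`.
* §5 the canonical live-family finset (the union over the component's cubes of the births felt there, or any sub-finset)
  is housed (`housed_of_subset_biUnion`), and the bridge to the ℝ-step currency: components read off a family of ℝ-steps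
  `R k : T4PreservedUnderR.RStep Bk` through the new birth `home k b` of the met component (`comp k b := (R k).comp (home k b)`,
  scale by `RStep.comp_scale`, volume by `RStep.CompVol`) — `count_of_rstep`.

HONEST FRAMING.  Finite combinatorics ([folklore]); rung (B)+1 bookkeeping on ONE finite four-torus — NOT infinite volume,
NOT a mass gap, NOT the Clay problem, NOT summit progress.  NOTHING of Bałaban's components, domains or D-terms is asserted:
which cubes form a met component, that live families are housed in it, the volume `v` ∕ side `ℓ`, the multiplicity `m` are
DISPLAYED BINDERS (the instantiation = node H2 + rows O3.E-iii-b∕-c).  Headline (trigger c4): «L-C ⇐ housing + component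
volume + positional count», never «NE1′ proved».  0 sorry; no `def … : Prop`.  Spine PROVED 0∕9 unchanged.  HONEST
DEPENDENCY: continuum YM on T⁴ ⇐ BetaPertH ∧ nine spine estimates (0/9 proved); BetaPertH ⇐ (D1) ∧ (D4) ∧ CAP+tail;
G-an2-4 gates asym, D1 and NE2/3/4.
-/

namespace Summit.QuantumFields.BalabanUV.T4Continuum.NE1p.DressedPositionalCount

open Finset
open scoped BigOperators
open Literature.MathematicalPhysics.QuantumFieldTheory.Balaban1983to89
open Literature.MathematicalPhysics.QuantumFieldTheory.Balaban1983to89.T4TermFormat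
open Literature.MathematicalPhysics.QuantumFieldTheory.Balaban1983to89.T4FeltGeometry
open Summit.QuantumFields.BalabanUV.T4Continuum.NE1p.DressedRoot

variable {Bk : T4TermFormat.Booking}

/-! ## §1 Monotonicity of the positional count -/

/-- `PositionalCount` is monotone in its profile. [folklore] -/
theorem positionalCount_mono {N N' : ℕ → ℕ → ℝ} (h : Bk.PositionalCount N) (hle : ∀ j k, N j k ≤ N' j k) :
    Bk.PositionalCount N' :=
  fun q j => (h q j).trans (hle j (Bk.cubeScale q))

/-! ## §2 Abstract layer: housing + component volume + positional count ⟹ `hS`, `hcount` -/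

/-- **`hS` FROM HOUSING** [bookkeeping]: if every live family of the met component of `b` at step `k` is felt at a cube of
the component, and the component's cubes have scale `k`, then live families are born: `birthScale f ≤ k`
(`Booking.felt_birth_le`).  Conclusion = the field type of `BookingLeaves.hS`. [folklore] -/
theorem birthScale_le_of_housed {comp : ℕ → Bk.Birth → Finset Bk.Cube} {S : ℕ → Bk.Birth → Finset Bk.Birth}
    (hscale : ∀ k b, ∀ q ∈ comp k b, Bk.cubeScale q = k)
    (hhoused : ∀ k b, ∀ f ∈ S k b, ∃ q ∈ comp k b, f ∈ Bk.feltAt q) :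
    ∀ k b, ∀ f ∈ S k b, Bk.birthScale f ≤ k := by
  intro k b f hf
  obtain ⟨q, hq, hfq⟩ := hhoused k b f hf
  rw [← hscale k b q hq]
  exact Bk.felt_birth_le q f hfq

/-- **THE COUNT PER COMPONENT** [bookkeeping]: live families of birth scale `j` housed in a component of at most `v` cubes
of scale `k` number at most `v · N j k` under `PositionalCount N` (the scale-`j` live families sit in the union over the
component's cubes of the scale-`j` births felt there; `card_biUnion_le`). [folklore] -/
theorem card_filter_live_le {comp : ℕ → Bk.Birth → Finset Bk.Cube} {S : ℕ → Bk.Birth → Finset Bk.Birth}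
    {N : ℕ → ℕ → ℝ} {v : ℕ} (hN : Bk.PositionalCount N)
    (hscale : ∀ k b, ∀ q ∈ comp k b, Bk.cubeScale q = k)
    (hhoused : ∀ k b, ∀ f ∈ S k b, ∃ q ∈ comp k b, f ∈ Bk.feltAt q)
    (hvol : ∀ k b, (comp k b).card ≤ v) (hN0 : ∀ j k, 0 ≤ N j k) (k : ℕ) (b : Bk.Birth) (j : ℕ) :
    (((S k b).filter fun f => Bk.birthScale f = j).card : ℝ) ≤ (v : ℝ) * N j k := by
  classical
  have hsub : ((S k b).filter fun f => Bk.birthScale f = j) ⊆ (comp k b).biUnion fun q => Bk.feltOfScale q j := by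
    intro f hf
    obtain ⟨hfS, hfj⟩ := mem_filter.mp hf
    obtain ⟨q, hq, hfq⟩ := hhoused k b f hfS
    exact mem_biUnion.mpr ⟨q, hq, Booking.mem_feltOfScale.mpr ⟨hfq, hfj⟩⟩
  have h1 : (((S k b).filter fun f => Bk.birthScale f = j).card : ℝ)
      ≤ ∑ q ∈ comp k b, ((Bk.feltOfScale q j).card : ℝ) := by
    have := (card_le_card hsub).trans (card_biUnion_le (s := comp k b) (t := fun q => Bk.feltOfScale q j))
    exact_mod_cast this
  calc (((S k b).filter fun f => Bk.birthScale f = j).card : ℝ)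
      ≤ ∑ q ∈ comp k b, ((Bk.feltOfScale q j).card : ℝ) := h1
    _ ≤ ∑ q ∈ comp k b, N j k := sum_le_sum fun q hq => by
        have h := hN q j
        rw [hscale k b q hq] at h
        exact h
    _ = ((comp k b).card : ℝ) * N j k := by rw [sum_const, nsmul_eq_mul]
    _ ≤ (v : ℝ) * N j k := mul_le_mul_of_nonneg_right (by exact_mod_cast hvol k b) (hN0 j k)

/-- **`hcount` FROM HOUSING + VOLUME + POSITIONAL COUNT** [bookkeeping]: with any displayed constants `N₀`, `Λ` dominating
`v · N j k ≤ N₀·Λ^{k−j}` (`j ≤ k`), the live families satisfy LITERALLY the field type of `BookingLeaves.hcount`. [folklore] -/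
theorem count_of_housed {comp : ℕ → Bk.Birth → Finset Bk.Cube} {S : ℕ → Bk.Birth → Finset Bk.Birth}
    {N : ℕ → ℕ → ℝ} {v : ℕ} {N₀ Λ : ℝ} (hN : Bk.PositionalCount N)
    (hscale : ∀ k b, ∀ q ∈ comp k b, Bk.cubeScale q = k)
    (hhoused : ∀ k b, ∀ f ∈ S k b, ∃ q ∈ comp k b, f ∈ Bk.feltAt q)
    (hvol : ∀ k b, (comp k b).card ≤ v) (hN0 : ∀ j k, 0 ≤ N j k)
    (hdom : ∀ j k, j ≤ k → (v : ℝ) * N j k ≤ N₀ * Λ ^ (k - j)) :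
    ∀ k b, ∀ j ≤ k, (((S k b).filter fun f => Bk.birthScale f = j).card : ℝ) ≤ N₀ * Λ ^ (k - j) :=
  fun k b j hj => (card_filter_live_le hN hscale hhoused hvol hN0 k b j).trans (hdom j k hj)

/-! ## §3 The anchoring instance (`T4FeltGeometry.Anchoring.positionalCount_of_anchoring` by name) -/

section AnchoringInstance

variable {d L : ℕ} (A : Anchoring Bk d L)

/-- **`hcount` FOR ANCHORED BOOKINGS** [bookkeeping]: a block-lattice anchoring with blocking factor `L > 0` and per-block
multiplicity `m` (every `j`-block lies in the domains of at most `m` births of scale `j`) gives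
`PositionalCount (m·(L^d)^{k−j})` (`positionalCount_of_anchoring`); with housing and component volume `v` the live-family
count is `≤ (v·m)·(L^d)^{k−j}` — `BookingLeaves.hcount` with `N₀ = v·m`, `Λ = L^d`. [folklore] -/
theorem count_of_anchoring (hL : 0 < L) {m v : ℕ}
    (hmult : ∀ j (x : Fin d → ℕ), (Bk.births.filter fun b => Bk.birthScale b = j ∧ x ∈ A.dom b).card ≤ m)
    {comp : ℕ → Bk.Birth → Finset Bk.Cube} {S : ℕ → Bk.Birth → Finset Bk.Birth}
    (hscale : ∀ k b, ∀ q ∈ comp k b, Bk.cubeScale q = k)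
    (hhoused : ∀ k b, ∀ f ∈ S k b, ∃ q ∈ comp k b, f ∈ Bk.feltAt q)
    (hvol : ∀ k b, (comp k b).card ≤ v) :
    ∀ k b, ∀ j ≤ k, (((S k b).filter fun f => Bk.birthScale f = j).card : ℝ)
      ≤ ((v : ℝ) * m) * ((L : ℝ) ^ d) ^ (k - j) := by
  refine count_of_housed (A.positionalCount_of_anchoring hL hmult) hscale hhoused hvol (fun j k => by positivity) ?_
  intro j k _
  rw [mul_assoc]

/-- **COMPONENT VOLUME FROM A BOX** [bookkeeping]: if the cubes of one scale have distinct blocks and the blocks of the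
component's cubes lie in a box of `ℓ` blocks per side (lower corner `lo`), the component has at most `ℓ^d` cubes — the
form in which a collared met component (inside a cube of `100M R_k` plus its collar layers) is K-free; `ℓ` DISPLAYED,
no numeral asserted from print. [folklore] -/
theorem card_le_of_center_box {T : Finset Bk.Cube} {k ℓ : ℕ} {lo : Fin d → ℕ}
    (hscale : ∀ q ∈ T, Bk.cubeScale q = k)
    (center_inj : ∀ q q' : Bk.Cube, Bk.cubeScale q = Bk.cubeScale q' → A.center q = A.center q' → q = q')
    (hbox : ∀ q ∈ T, A.center q ∈ Fintype.piFinset fun i => Ico (lo i) (lo i + ℓ)) :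
    T.card ≤ ℓ ^ d := by
  classical
  have hinj : Set.InjOn A.center (T : Set Bk.Cube) := by
    intro q hq q' hq' h
    exact center_inj q q' ((hscale q (Finset.mem_coe.mp hq)).trans (hscale q' (Finset.mem_coe.mp hq')).symm) h
  calc T.card ≤ (Fintype.piFinset fun i => Ico (lo i) (lo i + ℓ)).card := card_le_card_of_injOn A.center hbox hinj
    _ = ℓ ^ d := by
        rw [Fintype.card_piFinset]
        simp only [Nat.card_Ico, Nat.add_sub_cancel_left, prod_const, card_univ, Fintype.card_fin]

/-- **`hcount` FOR ANCHORED BOOKINGS WITH BOXED (COLLARED) COMPONENTS** [bookkeeping]: `count_of_anchoring` with the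
component volume read off a box of `ℓ` blocks per side per component: `N₀ = ℓ^d·m`, `Λ = L^d`. [folklore] -/
theorem count_of_anchoring_box (hL : 0 < L) {m ℓ : ℕ}
    (hmult : ∀ j (x : Fin d → ℕ), (Bk.births.filter fun b => Bk.birthScale b = j ∧ x ∈ A.dom b).card ≤ m)
    (center_inj : ∀ q q' : Bk.Cube, Bk.cubeScale q = Bk.cubeScale q' → A.center q = A.center q' → q = q')
    {comp : ℕ → Bk.Birth → Finset Bk.Cube} {S : ℕ → Bk.Birth → Finset Bk.Birth} {lo : ℕ → Bk.Birth → Fin d → ℕ}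
    (hscale : ∀ k b, ∀ q ∈ comp k b, Bk.cubeScale q = k)
    (hhoused : ∀ k b, ∀ f ∈ S k b, ∃ q ∈ comp k b, f ∈ Bk.feltAt q)
    (hbox : ∀ k b, ∀ q ∈ comp k b, A.center q ∈ Fintype.piFinset fun i => Ico (lo k b i) (lo k b i + ℓ)) :
    ∀ k b, ∀ j ≤ k, (((S k b).filter fun f => Bk.birthScale f = j).card : ℝ)
      ≤ (((ℓ ^ d : ℕ) : ℝ) * m) * ((L : ℝ) ^ d) ^ (k - j) :=
  count_of_anchoring A hL hmult hscale hhoused fun k b =>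
    card_le_of_center_box A (hscale k b) center_inj (hbox k b)

end AnchoringInstance

/-! ## §4 Packaged for `DressedRoot.BookingLeaves` -/

/-- **LEAF L-C FOR THE DRESSED FORMAT** [bookkeeping]: for a `U : UniformConstants` whose count constants dominate the
anchored ones (`v·m ≤ U.N₀`, `U.Λ = L^d`), housing + component volume + anchoring give BOTH fields `hS` and `hcount` of
`DressedRoot.BookingLeaves U Bk T` for the live-family finsets `S` — verbatim.  Nothing of Bałaban's components asserted;
`v`, `m`, the anchoring and the housing are displayed binders. [folklore] -/
theorem bookingCount_of_anchoring (U : UniformConstants) {d L : ℕ} (A : Anchoring Bk d L) (hL : 0 < L) {m v : ℕ}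
    (hmult : ∀ j (x : Fin d → ℕ), (Bk.births.filter fun b => Bk.birthScale b = j ∧ x ∈ A.dom b).card ≤ m)
    {comp : ℕ → Bk.Birth → Finset Bk.Cube} {S : ℕ → Bk.Birth → Finset Bk.Birth}
    (hscale : ∀ k b, ∀ q ∈ comp k b, Bk.cubeScale q = k)
    (hhoused : ∀ k b, ∀ f ∈ S k b, ∃ q ∈ comp k b, f ∈ Bk.feltAt q)
    (hvol : ∀ k b, (comp k b).card ≤ v) (hN₀ : (v : ℝ) * m ≤ U.N₀) (hΛ : U.Λ = (L : ℝ) ^ d) :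
    (∀ k b, ∀ f ∈ S k b, Bk.birthScale f ≤ k) ∧
      ∀ k b, ∀ j ≤ k, (((S k b).filter fun f => Bk.birthScale f = j).card : ℝ) ≤ U.N₀ * U.Λ ^ (k - j) := by
  refine ⟨birthScale_le_of_housed hscale hhoused, fun k b j hj => ?_⟩
  refine (count_of_anchoring A hL hmult hscale hhoused hvol k b j hj).trans ?_
  rw [hΛ]
  exact mul_le_mul_of_nonneg_right hN₀ (by positivity)

/-- The same U serves the booking-level positional count of `DressedRoot.cubeBudget_of_bookingLeaves`
(`PositionalCount (U.N₀·U.Λ^{k−j})`) as soon as `m ≤ U.N₀` (e.g. `1 ≤ v`): `positionalCount_mono`. [folklore] -/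
theorem positionalCount_uniform (U : UniformConstants) {d L : ℕ} (A : Anchoring Bk d L) (hL : 0 < L) {m : ℕ}
    (hmult : ∀ j (x : Fin d → ℕ), (Bk.births.filter fun b => Bk.birthScale b = j ∧ x ∈ A.dom b).card ≤ m)
    (hN₀ : (m : ℝ) ≤ U.N₀) (hΛ : U.Λ = (L : ℝ) ^ d) :
    Bk.PositionalCount fun j k => U.N₀ * U.Λ ^ (k - j) := by
  refine positionalCount_mono (A.positionalCount_of_anchoring hL hmult) fun j k => ?_
  rw [hΛ]
  exact mul_le_mul_of_nonneg_right hN₀ (by positivity)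

/-! ## §5 The canonical live families and the ℝ-step bridge -/

/-- **THE CANONICAL LIVE FAMILIES OF A COMPONENT ARE HOUSED** [bookkeeping]: any live-family finset inside the union over
the component's cubes of the births felt there (the canonical choice is that union itself) is housed. [folklore] -/
theorem housed_of_subset_biUnion [DecidableEq Bk.Birth] {comp : ℕ → Bk.Birth → Finset Bk.Cube}
    {S : ℕ → Bk.Birth → Finset Bk.Birth} (hsub : ∀ k b, S k b ⊆ (comp k b).biUnion Bk.feltAt) :
    ∀ k b, ∀ f ∈ S k b, ∃ q ∈ comp k b, f ∈ Bk.feltAt q :=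
  fun k b _ hf => mem_biUnion.mp (hsub k b hf)

/-- **THE ℝ-STEP BRIDGE** [bookkeeping]: read the met component of `b` at step `k` off the ℝ-step of scale `k` as the
(collared) component renormalised at a new birth `home k b` of scale `k` — `comp k b := (R k).comp (home k b)`, cubes of
scale `k` by `RStep.comp_scale`, at most `v` of them by `RStep.CompVol v` — and the count follows from housing and any
`PositionalCount N` with `v·N j k ≤ N₀·Λ^{k−j}`.  (Which new birth houses the component of an old family is instantiation
data; `home` is a displayed binder.) [folklore] -/
theorem count_of_rstep (R : ℕ → T4PreservedUnderR.RStep Bk) {v : ℕ} (hv : ∀ k, (R k).CompVol v)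
    (home : ℕ → Bk.Birth → Bk.Birth) (hhome : ∀ k b, Bk.birthScale (home k b) = k)
    {S : ℕ → Bk.Birth → Finset Bk.Birth}
    (hhoused : ∀ k b, ∀ f ∈ S k b, ∃ q ∈ (R k).comp (home k b), f ∈ Bk.feltAt q)
    {N : ℕ → ℕ → ℝ} (hN : Bk.PositionalCount N) (hN0 : ∀ j k, 0 ≤ N j k) {N₀ Λ : ℝ}
    (hdom : ∀ j k, j ≤ k → (v : ℝ) * N j k ≤ N₀ * Λ ^ (k - j)) :
    (∀ k b, ∀ f ∈ S k b, Bk.birthScale f ≤ k) ∧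
      ∀ k b, ∀ j ≤ k, (((S k b).filter fun f => Bk.birthScale f = j).card : ℝ) ≤ N₀ * Λ ^ (k - j) :=
  have hscale : ∀ k b, ∀ q ∈ (R k).comp (home k b), Bk.cubeScale q = k := fun k b q hq => by
    rw [(R k).comp_scale (home k b) q hq, hhome k b]
  ⟨birthScale_le_of_housed (comp := fun k b => (R k).comp (home k b)) hscale hhoused,
    count_of_housed (comp := fun k b => (R k).comp (home k b)) hN hscale hhoused (fun k b => hv k (home k b)) hN0 hdom⟩


/-! ## §6 (v1.1, APPEND-ONLY) Housing DISCHARGED in the ℝ-step currency: the absorbed families -/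

/-- **L-C WITH NO HOUSING BINDER** [bookkeeping]: take for the live families of the met component of `b` at step `k` the OLD
FAMILIES ABSORBED at the new birth `home k b` of that component, `S k b := (R k).absorbs (home k b)` (the `RStep` dictionary:
their carried generations are what the component's dressing integrates; «budgets add», [Balaban1989LargeFieldII] (1.69) p. 377
FORMAT only).  Then housing IS the `RStep` axiom `absorbs_felt` (an absorbed birth is felt at a cube of the component), so
`hS ∧ hcount` follow from the component volume `RStep.CompVol v` and any `PositionalCount N` with `v·N j k ≤ N₀·Λ^{k−j}` ALONE —
`count_of_rstep` with its `hhoused` discharged.  (`home` and the dictionary are instantiation data; nothing of Bałaban's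
components asserted.) [folklore] -/
theorem count_of_rstep_absorbs (R : ℕ → T4PreservedUnderR.RStep Bk) {v : ℕ} (hv : ∀ k, (R k).CompVol v)
    (home : ℕ → Bk.Birth → Bk.Birth) (hhome : ∀ k b, Bk.birthScale (home k b) = k)
    {N : ℕ → ℕ → ℝ} (hN : Bk.PositionalCount N) (hN0 : ∀ j k, 0 ≤ N j k) {N₀ Λ : ℝ}
    (hdom : ∀ j k, j ≤ k → (v : ℝ) * N j k ≤ N₀ * Λ ^ (k - j)) :
    (∀ k b, ∀ f ∈ (R k).absorbs (home k b), Bk.birthScale f ≤ k) ∧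
      ∀ k b, ∀ j ≤ k,
        ((((R k).absorbs (home k b)).filter fun f => Bk.birthScale f = j).card : ℝ) ≤ N₀ * Λ ^ (k - j) :=
  count_of_rstep R hv home hhome (S := fun k b => (R k).absorbs (home k b))
    (fun k b f hf => (R k).absorbs_felt (home k b) f hf) hN hN0 hdom

/-- In the absorbed-families dictionary the live families are born STRICTLY before the step (`RStep.absorbs_lt`) — the
sharper form of `hS` the regeneration ∕ birth slots may use. [folklore] -/
theorem birthScale_lt_of_absorbs (R : ℕ → T4PreservedUnderR.RStep Bk) (home : ℕ → Bk.Birth → Bk.Birth)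
    (hhome : ∀ k b, Bk.birthScale (home k b) = k) :
    ∀ k b, ∀ f ∈ (R k).absorbs (home k b), Bk.birthScale f < k := fun k b f hf => by
  rw [← hhome k b]
  exact (R k).absorbs_lt (home k b) f hf

/-- **L-C FOR ANCHORED BOOKINGS IN THE ABSORBED-FAMILIES DICTIONARY** [bookkeeping]: `count_of_rstep_absorbs` with the
positional count from a block-lattice anchoring (`T4FeltGeometry.Anchoring.positionalCount_of_anchoring`, multiplicity `m`,
`0 < L`): `hS ∧ hcount` with `N₀ = v·m`, `Λ = L^d` from the component volume `v` ALONE. [folklore] -/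
theorem count_of_rstep_absorbs_anchoring {d L : ℕ} (A : Anchoring Bk d L) (hL : 0 < L) {m : ℕ}
    (hmult : ∀ j (x : Fin d → ℕ), (Bk.births.filter fun b => Bk.birthScale b = j ∧ x ∈ A.dom b).card ≤ m)
    (R : ℕ → T4PreservedUnderR.RStep Bk) {v : ℕ} (hv : ∀ k, (R k).CompVol v)
    (home : ℕ → Bk.Birth → Bk.Birth) (hhome : ∀ k b, Bk.birthScale (home k b) = k) :
    (∀ k b, ∀ f ∈ (R k).absorbs (home k b), Bk.birthScale f ≤ k) ∧
      ∀ k b, ∀ j ≤ k,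
        ((((R k).absorbs (home k b)).filter fun f => Bk.birthScale f = j).card : ℝ)
          ≤ ((v : ℝ) * m) * ((L : ℝ) ^ d) ^ (k - j) :=
  count_of_rstep_absorbs R hv home hhome (A.positionalCount_of_anchoring hL hmult) (fun j k => by positivity)
    fun j k _ => by rw [mul_assoc]

end Summit.QuantumFields.BalabanUV.T4Continuum.NE1p.DressedPositionalCount
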